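import Mathlib
import Summits.AnomalousDissipation.AnomalousDissipation.Theses.PointSink

/-!
# `PointSink.SolitonTransplant` (stmt-AnomalousDissipation-19035): three conjuncts of the
antecedent are NOT load-bearing

cdisprove record (route `AnomalousDissipation/PointSink`, crux `SolitonTransplant`, whose
antecedent is verbatim the node statement `CascadeSoliton`, stmt-19036). The antecedent is the
conjunction of
(1) `(Q, P)` is a smooth steady unforced unit-viscosity Navier–Stokes solution on `ℝ³`;
(2) the `L²`-mass envelope `∫_{B_R} ‖Q‖² ≤ C R^{5/3}` (`R ≥ 1`);
(3) `|∇Q|²` is integrable;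
(4) `0 < ∫ |∇Q|²`;
(5) a non-trivial discretely self-similar far field `V` of degree `-2/3` with
    `λ^{-5k/3} ∫_{λ^k < ‖x‖ < λ^{k+1}} ‖Q - V‖² → 0`.

We prove that (2), (3) and (4) carry no weight — the load-bearing content of the antecedent is
(1) ∧ (3) ∧ (5) ("a D-solution with zero force and a non-trivial DSS(−2/3) blow-down"):

* `integrable_gradSq_of_pos` — (4) ⇒ (3) (Bochner junk: a non-integrable function has integral
  `0`);
* `dissipation_pos_of_farField` — (1) ∧ (2) ∧ (3) ∧ (5) ⇒ (4): if `∫ |∇Q|² = 0` then `∇Q ≡ 0`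
  (continuous non-negative integrand), so `Q` is a constant `c`; the envelope forces `c = 0`
  (`‖c‖² |B_1| R³ ≤ C R^{5/3}` fails for large `R`), and then the far-field clause reads
  `λ^{-5k/3} ∫_{shell k} ‖V‖² → 0`, while by self-similarity this sequence is the positive
  constant `∫_{1<‖x‖<λ} ‖V‖²` — contradiction. Only smoothness of `Q` is used from (1);
* (companion file `AntecedentEnvelope.lean`) `envelope_of_farField` — continuity of `Q` ∧ (5) ⇒
  (2), and `solitonTransplant_iff_minimal`: the crux ↔ the implication from (1) ∧ (3) ∧ (5).

Consequently the crux with (3) or (4) deleted from its antecedent is EQUIVALENT to the crux as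
filed (`solitonTransplant_iff_without_integrable`, `solitonTransplant_iff_without_pos`): any
disproof or proof may ignore them, and a prover of `ConeDesingularisation` gets (4) for free from
the far-field clause. Classification: negative/tightness lemma about the hypotheses of the crux
(no verdict change). [folklore]
-/

set_option linter.dupNamespace false  -- `Summit.AnomalousDissipation.AnomalousDissipation` is the mandated summit/problem namespace

noncomputable section

open MeasureTheory Metric Filter Topology Set
open scoped Pointwise ENNReal
open Literature.Analysis.FluidPDE

namespace Summit.AnomalousDissipation.AnomalousDissipation.Theorems.SolitonTransplant.Negative

/-- (4) ⇒ (3): a strictly positive Bochner integral is the integral of an integrable function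
(`MeasureTheory.integral_undef`). [folklore] -/
theorem integrable_gradSq_of_pos {Q : (EuclideanSpace ℝ (Fin 3)) → (EuclideanSpace ℝ (Fin 3))}
    (hpos : 0 < ∫ x, frobeniusNormSq (fderiv ℝ Q x)) :
    Integrable (fun x => frobeniusNormSq (fderiv ℝ Q x)) := by
  by_contra h
  rw [integral_undef h] at hpos
  exact lt_irrefl _ hpos

/-- Discrete self-similarity iterates: `V (λ^k x) = (λ^{-2/3})^k V x` off the origin. [folklore] -/
theorem dss_iterate {lam : ℝ} (hlam : 0 < lam) {V : (EuclideanSpace ℝ (Fin 3)) → (EuclideanSpace ℝ (Fin 3))}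
    (hV : ∀ x : (EuclideanSpace ℝ (Fin 3)), x ≠ 0 → V (lam • x) = lam ^ (-(2 / 3 : ℝ)) • V x) (k : ℕ) (x : (EuclideanSpace ℝ (Fin 3)))
    (hx : x ≠ 0) : V (lam ^ k • x) = (lam ^ (-(2 / 3 : ℝ))) ^ k • V x := by
  induction k with
  | zero => simp
  | succ k ih =>
    have hk : lam ^ k • x ≠ 0 := smul_ne_zero (pow_ne_zero _ hlam.ne') hx
    rw [pow_succ, mul_comm, mul_smul, hV _ hk, ih, smul_smul, ← pow_succ']

/-- The dilate of the fundamental shell is the `k`-th shell: `λ^k • {1 < ‖x‖ < λ} =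
{λ^k < ‖x‖ < λ^{k+1}}`. [folklore] -/
theorem smul_shell_eq {lam : ℝ} (hlam : 0 < lam) (k : ℕ) :
    (lam ^ k) • {x : (EuclideanSpace ℝ (Fin 3)) | 1 < ‖x‖ ∧ ‖x‖ < lam} =
      {x : (EuclideanSpace ℝ (Fin 3)) | lam ^ k < ‖x‖ ∧ ‖x‖ < lam ^ (k + 1)} := by
  have hc : 0 < lam ^ k := pow_pos hlam k
  ext x
  rw [Set.mem_smul_set_iff_inv_smul_mem₀ hc.ne']
  simp only [mem_setOf_eq, norm_smul, norm_inv, Real.norm_eq_abs, abs_of_pos hc]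
  rw [← div_eq_inv_mul, lt_div_iff₀ hc, div_lt_iff₀ hc, one_mul, pow_succ, mul_comm]

/-- Self-similar scaling of the shell energies: `∫_{shell k} ‖V‖² = λ^{3k} (λ^{-2/3})^{2k}
∫_{shell 0} ‖V‖²`. [folklore] -/
theorem setIntegral_shell_eq {lam : ℝ} (hlam : 0 < lam) {V : (EuclideanSpace ℝ (Fin 3)) → (EuclideanSpace ℝ (Fin 3))}
    (hV : ∀ x : (EuclideanSpace ℝ (Fin 3)), x ≠ 0 → V (lam • x) = lam ^ (-(2 / 3 : ℝ)) • V x) (k : ℕ) :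
    ∫ x in {x : (EuclideanSpace ℝ (Fin 3)) | lam ^ k < ‖x‖ ∧ ‖x‖ < lam ^ (k + 1)}, ‖V x‖ ^ 2 =
      (lam ^ k) ^ 3 * ((lam ^ (-(2 / 3 : ℝ))) ^ k) ^ 2 *
        ∫ x in {x : (EuclideanSpace ℝ (Fin 3)) | 1 < ‖x‖ ∧ ‖x‖ < lam}, ‖V x‖ ^ 2 := by
  have hc : 0 < lam ^ k := pow_pos hlam k
  have hsub := Measure.setIntegral_comp_smul_of_pos (volume : Measure (EuclideanSpace ℝ (Fin 3)))
    (fun x => ‖V x‖ ^ 2) {x : (EuclideanSpace ℝ (Fin 3)) | 1 < ‖x‖ ∧ ‖x‖ < lam} hc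
  rw [smul_shell_eq hlam k, finrank_euclideanSpace_fin, smul_eq_mul] at hsub
  -- evaluate the left-hand side of `hsub` by self-similarity on the fundamental shell
  have hS : MeasurableSet {x : (EuclideanSpace ℝ (Fin 3)) | 1 < ‖x‖ ∧ ‖x‖ < lam} :=
    (measurableSet_lt measurable_const measurable_norm).inter
      (measurableSet_lt measurable_norm measurable_const)
  have hcongr : ∫ x in {x : (EuclideanSpace ℝ (Fin 3)) | 1 < ‖x‖ ∧ ‖x‖ < lam}, ‖V (lam ^ k • x)‖ ^ 2 =
      ∫ x in {x : (EuclideanSpace ℝ (Fin 3)) | 1 < ‖x‖ ∧ ‖x‖ < lam}, ((lam ^ (-(2 / 3 : ℝ))) ^ k) ^ 2 * ‖V x‖ ^ 2 := by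
    refine setIntegral_congr_fun hS fun x hx => ?_
    have hx0 : x ≠ 0 := by
      rintro rfl
      simp only [mem_setOf_eq, norm_zero] at hx
      linarith [hx.1]
    rw [dss_iterate hlam hV k x hx0, norm_smul, mul_pow, Real.norm_eq_abs, sq_abs]
  rw [hcongr, integral_const_mul] at hsub
  have hc3 : (lam ^ k) ^ 3 ≠ 0 := pow_ne_zero _ hc.ne'
  have hsolve : ∫ x in {x : (EuclideanSpace ℝ (Fin 3)) | lam ^ k < ‖x‖ ∧ ‖x‖ < lam ^ (k + 1)}, ‖V x‖ ^ 2 =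
      (lam ^ k) ^ 3 * (((lam ^ (-(2 / 3 : ℝ))) ^ k) ^ 2 *
        ∫ x in {x : (EuclideanSpace ℝ (Fin 3)) | 1 < ‖x‖ ∧ ‖x‖ < lam}, ‖V x‖ ^ 2) := by
    rw [hsub, ← mul_assoc, mul_inv_cancel₀ hc3, one_mul]
  rw [hsolve]
  ring

/-- (1) ∧ (2) ∧ (3) ∧ (5) ⇒ (4): for a `C¹` field `Q` with integrable `|∇Q|²`, the envelope
`∫_{B_R}‖Q‖² ≤ C R^{5/3}` (`R ≥ 1`) and a far field matching a NON-TRIVIAL discretely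
self-similar profile, the dissipation `∫ |∇Q|²` is automatically positive. (Only `C¹`
smoothness is used from the Navier–Stokes clause.) [folklore] -/
theorem dissipation_pos_of_farField {Q : (EuclideanSpace ℝ (Fin 3)) → (EuclideanSpace ℝ (Fin 3))} (hQ : ContDiff ℝ 1 Q)
    (henv : ∃ C : ℝ, ∀ R : ℝ, 1 ≤ R → ∫ x in ball (0 : (EuclideanSpace ℝ (Fin 3))) R, ‖Q x‖ ^ 2 ≤ C * R ^ (5 / 3 : ℝ))
    (hint : Integrable (fun x => frobeniusNormSq (fderiv ℝ Q x)))
    {lam : ℝ} (hlam : 1 < lam) {V : (EuclideanSpace ℝ (Fin 3)) → (EuclideanSpace ℝ (Fin 3))}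
    (hV : ∀ x : (EuclideanSpace ℝ (Fin 3)), x ≠ 0 → V (lam • x) = lam ^ (-(2 / 3 : ℝ)) • V x)
    (hV0 : 0 < ∫ x in {x : (EuclideanSpace ℝ (Fin 3)) | 1 < ‖x‖ ∧ ‖x‖ < lam}, ‖V x‖ ^ 2)
    (hfar : Tendsto (fun k : ℕ => (lam ^ k) ^ (-(5 / 3 : ℝ)) *
      ∫ x in {x : (EuclideanSpace ℝ (Fin 3)) | lam ^ k < ‖x‖ ∧ ‖x‖ < lam ^ (k + 1)}, ‖Q x - V x‖ ^ 2) atTop (𝓝 0)) :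
    0 < ∫ x, frobeniusNormSq (fderiv ℝ Q x) := by
  have hlam0 : 0 < lam := lt_trans one_pos hlam
  by_contra hnot
  -- Step 1: `∫ |∇Q|² = 0`, hence `∇Q ≡ 0` and `Q` is constant.
  have hG0 : ∀ x, 0 ≤ frobeniusNormSq (fderiv ℝ Q x) := fun x => frobeniusNormSq_nonneg _
  have hzero : ∫ x, frobeniusNormSq (fderiv ℝ Q x) = 0 :=
    le_antisymm (not_lt.mp hnot) (integral_nonneg hG0)
  have hae : (fun x => frobeniusNormSq (fderiv ℝ Q x)) =ᵐ[volume] 0 :=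
    (integral_eq_zero_iff_of_nonneg hG0 hint).mp hzero
  have hcontF : Continuous fun L : (EuclideanSpace ℝ (Fin 3)) →L[ℝ] (EuclideanSpace ℝ (Fin 3)) => frobeniusNormSq L := by
    unfold frobeniusNormSq
    exact continuous_finsetSum _ fun i _ =>
      ((ContinuousLinearMap.apply ℝ (EuclideanSpace ℝ (Fin 3)) (stdOrthonormalBasis ℝ (EuclideanSpace ℝ (Fin 3)) i)).continuous.norm).pow 2
  have hcont : Continuous fun x => frobeniusNormSq (fderiv ℝ Q x) :=
    hcontF.comp (hQ.continuous_fderiv one_ne_zero)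
  have hfun : (fun x => frobeniusNormSq (fderiv ℝ Q x)) = 0 :=
    (Continuous.ae_eq_iff_eq volume hcont continuous_const).mp hae
  have hfd : ∀ x, fderiv ℝ Q x = 0 := by
    intro x
    have hx : frobeniusNormSq (fderiv ℝ Q x) = 0 := congrFun hfun x
    -- `∑ᵢ ‖L eᵢ‖² = 0` forces `L eᵢ = 0` for the orthonormal basis vectors, hence `L = 0`
    unfold frobeniusNormSq at hx
    have hterm : ∀ i, ‖fderiv ℝ Q x (stdOrthonormalBasis ℝ (EuclideanSpace ℝ (Fin 3)) i)‖ ^ 2 = 0 := fun i =>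
      (Finset.sum_eq_zero_iff_of_nonneg (fun j _ => sq_nonneg _)).mp hx i (Finset.mem_univ i)
    have hb : ∀ i, fderiv ℝ Q x (stdOrthonormalBasis ℝ (EuclideanSpace ℝ (Fin 3)) i) = 0 := fun i => by
      simpa using hterm i
    ext v
    have hv := (stdOrthonormalBasis ℝ (EuclideanSpace ℝ (Fin 3))).sum_repr v
    rw [← hv, map_sum]
    simp [map_smul, hb]
  have hconst : ∀ x, Q x = Q 0 := fun x =>
    is_const_of_fderiv_eq_zero (hQ.differentiable one_ne_zero) hfd x 0
  -- Step 2: the envelope forces the constant to vanish.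
  set c : (EuclideanSpace ℝ (Fin 3)) := Q 0 with hc_def
  obtain ⟨C, hC⟩ := henv
  have hvol1 : 0 < (volume (ball (0 : (EuclideanSpace ℝ (Fin 3))) 1)).toReal :=
    ENNReal.toReal_pos (measure_ball_pos volume (0 : (EuclideanSpace ℝ (Fin 3))) one_pos).ne' measure_ball_lt_top.ne
  have hball : ∀ R : ℝ, 1 ≤ R →
      ∫ x in ball (0 : (EuclideanSpace ℝ (Fin 3))) R, ‖Q x‖ ^ 2 = ‖c‖ ^ 2 * (volume (ball (0 : (EuclideanSpace ℝ (Fin 3))) 1)).toReal * R ^ 3 := by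
    intro R hR
    have hR0 : 0 < R := lt_of_lt_of_le one_pos hR
    have h1 : ∫ x in ball (0 : (EuclideanSpace ℝ (Fin 3))) R, ‖Q x‖ ^ 2 = ∫ x in ball (0 : (EuclideanSpace ℝ (Fin 3))) R, ‖c‖ ^ 2 :=
      setIntegral_congr_fun measurableSet_ball fun x _ => by rw [hconst x]
    rw [h1, setIntegral_const, smul_eq_mul, measureReal_def,
      Measure.addHaar_ball_of_pos volume (0 : (EuclideanSpace ℝ (Fin 3))) hR0, finrank_euclideanSpace_fin,
      ENNReal.toReal_mul, ENNReal.toReal_ofReal (by positivity)]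
    ring
  have hc0 : c = 0 := by
    by_contra hc
    have hcpos : 0 < ‖c‖ ^ 2 := by positivity
    set a : ℝ := ‖c‖ ^ 2 * (volume (ball (0 : (EuclideanSpace ℝ (Fin 3))) 1)).toReal with ha_def
    have ha : 0 < a := mul_pos hcpos hvol1
    -- from the envelope: `a * R ≤ C` for every `R ≥ 1`
    have hle : ∀ R : ℝ, 1 ≤ R → a * R ≤ C := by
      intro R hR
      have hR0 : 0 < R := lt_of_lt_of_le one_pos hR
      have h53 : 0 < R ^ (5 / 3 : ℝ) := Real.rpow_pos_of_pos hR0 _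
      have hsplit : R ^ 3 = R ^ (5 / 3 : ℝ) * R ^ (4 / 3 : ℝ) := by
        rw [← Real.rpow_add hR0]; norm_num
      have h43 : R ≤ R ^ (4 / 3 : ℝ) := by
        calc R = R ^ (1 : ℝ) := (Real.rpow_one R).symm
          _ ≤ R ^ (4 / 3 : ℝ) := Real.rpow_le_rpow_of_exponent_le hR (by norm_num)
      have henvR := hC R hR
      rw [hball R hR, hsplit] at henvR
      have : a * R * R ^ (5 / 3 : ℝ) ≤ C * R ^ (5 / 3 : ℝ) := by
        calc a * R * R ^ (5 / 3 : ℝ) ≤ a * R ^ (4 / 3 : ℝ) * R ^ (5 / 3 : ℝ) := by gcongr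
          _ = a * (R ^ (5 / 3 : ℝ) * R ^ (4 / 3 : ℝ)) := by ring
          _ ≤ C * R ^ (5 / 3 : ℝ) := henvR
      exact le_of_mul_le_mul_right this h53
    have hC0 : 0 ≤ C := le_trans (by positivity) (hle 1 le_rfl)
    have hbad := hle (C / a + 1) (by
      have : 0 ≤ C / a := div_nonneg hC0 ha.le
      linarith)
    rw [mul_add, mul_div_cancel₀ _ ha.ne', mul_one] at hbad
    linarith
  -- Step 3: with `Q ≡ 0` the far-field sequence is the positive constant `∫_{shell 0} ‖V‖²`.
  have hQ0 : ∀ x, Q x = 0 := fun x => (hconst x).trans hc0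
  set I₀ : ℝ := ∫ x in {x : (EuclideanSpace ℝ (Fin 3)) | 1 < ‖x‖ ∧ ‖x‖ < lam}, ‖V x‖ ^ 2 with hI₀_def
  have hseq : ∀ k : ℕ, (lam ^ k) ^ (-(5 / 3 : ℝ)) *
      ∫ x in {x : (EuclideanSpace ℝ (Fin 3)) | lam ^ k < ‖x‖ ∧ ‖x‖ < lam ^ (k + 1)}, ‖Q x - V x‖ ^ 2 = I₀ := by
    intro k
    have h1 : (fun x => ‖Q x - V x‖ ^ 2) = fun x => ‖V x‖ ^ 2 := by
      funext x; rw [hQ0 x, zero_sub, norm_neg]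
    rw [h1, setIntegral_shell_eq hlam0 hV k, ← hI₀_def]
    have hk : (0 : ℝ) < lam ^ k := pow_pos hlam0 k
    -- exponent bookkeeping: `(λ^k)^{-5/3} (λ^k)^3 ((λ^{-2/3})^k)^2 = 1`
    have hpow : (lam ^ k) ^ (-(5 / 3 : ℝ)) * ((lam ^ k) ^ 3 * ((lam ^ (-(2 / 3 : ℝ))) ^ k) ^ 2)
        = 1 := by
      have e1 : (lam ^ k : ℝ) = lam ^ (k : ℝ) := (Real.rpow_natCast lam k).symm
      have e2 : ((lam ^ (-(2 / 3 : ℝ))) ^ k) = lam ^ (-(2 / 3 : ℝ) * k) := by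
        rw [Real.rpow_mul hlam0.le, Real.rpow_natCast]
      rw [e1, e2, ← Real.rpow_mul hlam0.le, ← Real.rpow_natCast (lam ^ (k : ℝ)) 3,
        ← Real.rpow_mul hlam0.le, ← Real.rpow_natCast (lam ^ (-(2 / 3 : ℝ) * k)) 2,
        ← Real.rpow_mul hlam0.le, ← Real.rpow_add hlam0, ← Real.rpow_add hlam0]
      norm_num
      ring_nf
      simp
    calc (lam ^ k) ^ (-(5 / 3 : ℝ)) * ((lam ^ k) ^ 3 * ((lam ^ (-(2 / 3 : ℝ))) ^ k) ^ 2 * I₀)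
        = ((lam ^ k) ^ (-(5 / 3 : ℝ)) * ((lam ^ k) ^ 3 * ((lam ^ (-(2 / 3 : ℝ))) ^ k) ^ 2)) * I₀ :=
          by ring
      _ = I₀ := by rw [hpow, one_mul]
  have hlim : Tendsto (fun _ : ℕ => I₀) atTop (𝓝 0) := by
    refine hfar.congr' (Eventually.of_forall fun k => ?_)
    exact hseq k
  have hI0 : I₀ = 0 := tendsto_nhds_unique tendsto_const_nhds hlim
  exact absurd hI0 hV0.ne'

/-! ## The crux with a redundant conjunct deleted is the crux -/

open Summit.AnomalousDissipation.AnomalousDissipation.Theses.PointSink in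
/-- **(4) is not load-bearing.** `SolitonTransplant` is equivalent to the same implication with
the positivity clause `0 < ∫ |∇Q|²` deleted from its antecedent (the deleted clause follows from
the others by `dissipation_pos_of_farField`). [folklore] -/
theorem solitonTransplant_iff_without_pos :
    SolitonTransplant ↔
      ((∃ (Q : EuclideanSpace ℝ (Fin 3) → EuclideanSpace ℝ (Fin 3)) (P : EuclideanSpace ℝ (Fin 3) → ℝ), Literature.Analysis.FluidPDE.IsClassicalNSSolutionOn Set.univ 1 (fun _ _ => 0) (fun _ => Q) (fun _ => P) ∧ (∃ C : ℝ, ∀ R : ℝ, 1 ≤ R → ∫ x in Metric.ball (0 : EuclideanSpace ℝ (Fin 3)) R, ‖Q x‖ ^ 2 ≤ C * R ^ (5 / 3 : ℝ)) ∧ MeasureTheory.Integrable (fun x => Literature.Analysis.FluidPDE.frobeniusNormSq (fderiv ℝ Q x)) ∧ ∃ (lam : ℝ) (V : EuclideanSpace ℝ (Fin 3) → EuclideanSpace ℝ (Fin 3)), 1 < lam ∧ MeasureTheory.AEStronglyMeasurable V MeasureTheory.volume ∧ (∀ x : EuclideanSpace ℝ (Fin 3), x ≠ 0 → V (lam • x)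 = lam ^ (-(2 / 3 : ℝ)) • V x) ∧ MeasureTheory.LocallyIntegrableOn (fun x => ‖V x‖ ^ 2) {x : EuclideanSpace ℝ (Fin 3) | x ≠ 0} MeasureTheory.volume ∧ 0 < ∫ x in {x : EuclideanSpace ℝ (Fin 3) | 1 < ‖x‖ ∧ ‖x‖ < lam}, ‖V x‖ ^ 2 ∧ Filter.Tendsto (fun k : ℕ => (lam ^ k) ^ (-(5 / 3 : ℝ)) * ∫ x in {x : EuclideanSpace ℝ (Fin 3) | lam ^ k < ‖x‖ ∧ ‖x‖ < lam ^ (k + 1)}, ‖Q x - V x‖ ^ 2) Filter.atTop (nhds 0)) → PointSinkZerothLaw) := by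
  constructor
  · rintro h ⟨Q, P, h1, h2, h3, lam, V, hlam, hVm, hV, hVloc, hV0, hfar⟩
    have hQ : ContDiff ℝ 1 Q :=
      (h1.contDiff_velocity (Set.mem_univ (0 : ℝ))).of_le (by exact_mod_cast le_top)
    exact h ⟨Q, P, h1, h2, h3, dissipation_pos_of_farField hQ h2 h3 hlam hV hV0 hfar, lam, V, hlam,
      hVm, hV, hVloc, hV0, hfar⟩
  · rintro h ⟨Q, P, h1, h2, h3, -, h5⟩
    exact h ⟨Q, P, h1, h2, h3, h5⟩

open Summit.AnomalousDissipation.AnomalousDissipation.Theses.PointSink in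
/-- **(3) is not load-bearing.** `SolitonTransplant` is equivalent to the same implication with
the integrability clause `|∇Q|² ∈ L¹` deleted from its antecedent (it follows from `0 < ∫ |∇Q|²`
by `integrable_gradSq_of_pos`). [folklore] -/
theorem solitonTransplant_iff_without_integrable :
    SolitonTransplant ↔
      ((∃ (Q : EuclideanSpace ℝ (Fin 3) → EuclideanSpace ℝ (Fin 3)) (P : EuclideanSpace ℝ (Fin 3) → ℝ), Literature.Analysis.FluidPDE.IsClassicalNSSolutionOn Set.univ 1 (fun _ _ => 0) (fun _ => Q) (fun _ => P) ∧ (∃ C : ℝ, ∀ R : ℝ, 1 ≤ R → ∫ x in Metric.ball (0 : EuclideanSpace ℝ (Fin 3)) R, ‖Q x‖ ^ 2 ≤ C * R ^ (5 / 3 : ℝ)) ∧ 0 < ∫ x, Literature.Analysis.FluidPDE.frobeniusNormSq (fderiv ℝ Q x) ∧ ∃ (lam : ℝ) (V : EuclideanSpace ℝ (Fin 3) → EuclideanSpace ℝ (Fin 3)), 1 < lam ∧ MeasureTheory.AEStronglyMeasurable V MeasureTheory.volume ∧ (∀ x : EuclideanSpace ℝ (Fin 3), x ≠ 0 → V (lam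 • x) = lam ^ (-(2 / 3 : ℝ)) • V x) ∧ MeasureTheory.LocallyIntegrableOn (fun x => ‖V x‖ ^ 2) {x : EuclideanSpace ℝ (Fin 3) | x ≠ 0} MeasureTheory.volume ∧ 0 < ∫ x in {x : EuclideanSpace ℝ (Fin 3) | 1 < ‖x‖ ∧ ‖x‖ < lam}, ‖V x‖ ^ 2 ∧ Filter.Tendsto (fun k : ℕ => (lam ^ k) ^ (-(5 / 3 : ℝ)) * ∫ x in {x : EuclideanSpace ℝ (Fin 3) | lam ^ k < ‖x‖ ∧ ‖x‖ < lam ^ (k + 1)}, ‖Q x - V x‖ ^ 2) Filter.atTop (nhds 0)) → PointSinkZerothLaw) := by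
  constructor
  · rintro h ⟨Q, P, h1, h2, h4, h5⟩
    exact h ⟨Q, P, h1, h2, integrable_gradSq_of_pos h4, h4, h5⟩
  · rintro h ⟨Q, P, h1, h2, -, h4, h5⟩
    exact h ⟨Q, P, h1, h2, h4, h5⟩

end Summit.AnomalousDissipation.AnomalousDissipation.Theorems.SolitonTransplant.Negative

end
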